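import Summits.ValiantsHypothesis.ValiantsHypothesis.Theorems.FeketeSOSFeketeSOSHardPaleyRIPDefs
import Mathlib.Algebra.BigOperators.Fin
import Mathlib.Data.Fin.Tuple.Basic
import Mathlib.Algebra.Polynomial.Basic
import Mathlib.Analysis.Complex.Basic

/-!
# Route FeketeSOS — crux `FeketeSOSHard` (stmt-ValiantsHypothesis-3996), line `paley-rip` (skeleton v3):
# toolkit — weighted-square families are closed under concatenation and rescaling (patterns add, masses add)

Every decomposition argument for the operator stub `stub_tameOperator` (census `Lines/paley-rip-stub3-census.md` §9–§10:
block decompositions on `S = D + H`, multiscale splittings, peeling of structured parts) combines cheap representations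
of partial patterns.  This file records the bookkeeping once, in the line's vocabulary (families `(c_j, w_j)_{j<s}`,
cyclic patterns modulo `X^p − 1`, archimedean mass `Σ_j sqMass c_j w_j`):

* `sum_sq_append`, `sum_sqMass_append` — concatenating two families (`Fin.append`) adds the square-sums and the masses;
* `tame_add` — if `F₁`, `F₂` are carried by families supported in `S` of masses `≤ M₁`, `≤ M₂`, then `F₁ + F₂` is carried by a
  family supported in `S` of mass `≤ M₁ + M₂`;
* `sum_sq_smul`, `sqMass_smul`, `tame_smul` — rescaling all weights by `κ` multiplies the pattern by `κ` and the mass by `|κ|`;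
* `tame_sum` — finite sums: if each `F_t` (`t ∈ T`) is carried inside `S` with mass `≤ M_t`, then `Σ_t F_t` is carried inside
  `S` with mass `≤ Σ_t M_t`.

Honest framing: bookkeeping only; `stub_tameOperator`, the engine and the crux stay OPEN; `VP ≠ VNP` untouched.
-/

set_option linter.dupNamespace false

namespace Summit.ValiantsHypothesis.ValiantsHypothesis.Theorems.FeketeSOSHardPaleyRIP

open Polynomial Finset
open scoped BigOperators

noncomputable section

section Toolkit

/-- Concatenation adds the weighted square-sums. [folklore] -/
theorem sum_sq_append {s₁ s₂ : ℕ} (c₁ : Fin s₁ → ℂ) (w₁ : Fin s₁ → ℂ[X]) (c₂ : Fin s₂ → ℂ) (w₂ : Fin s₂ → ℂ[X]) :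
    (∑ j : Fin (s₁ + s₂), C (Fin.append c₁ c₂ j) * Fin.append w₁ w₂ j ^ 2) =
      (∑ j, C (c₁ j) * w₁ j ^ 2) + ∑ j, C (c₂ j) * w₂ j ^ 2 := by
  rw [Fin.sum_univ_add]
  simp only [Fin.append_left, Fin.append_right]

/-- Concatenation adds the masses. [folklore] -/
theorem sum_sqMass_append {s₁ s₂ : ℕ} (c₁ : Fin s₁ → ℂ) (w₁ : Fin s₁ → ℂ[X]) (c₂ : Fin s₂ → ℂ) (w₂ : Fin s₂ → ℂ[X]) :
    (∑ j : Fin (s₁ + s₂), sqMass (Fin.append c₁ c₂ j) (Fin.append w₁ w₂ j)) =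
      (∑ j, sqMass (c₁ j) (w₁ j)) + ∑ j, sqMass (c₂ j) (w₂ j) := by
  rw [Fin.sum_univ_add]
  simp only [Fin.append_left, Fin.append_right]

/-- Supports are preserved by concatenation. [folklore] -/
theorem support_append_subset {s₁ s₂ : ℕ} {S : Finset ℕ} (w₁ : Fin s₁ → ℂ[X]) (w₂ : Fin s₂ → ℂ[X])
    (h₁ : ∀ j, (w₁ j).support ⊆ S) (h₂ : ∀ j, (w₂ j).support ⊆ S) :
    ∀ j, (Fin.append w₁ w₂ j).support ⊆ S := by
  intro j
  refine Fin.addCases (fun i => ?_) (fun i => ?_) j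
  · rw [Fin.append_left]; exact h₁ i
  · rw [Fin.append_right]; exact h₂ i

/-- **Additivity of tameness.**  If `F₁` and `F₂` are each carried, modulo `X^p − 1`, by weighted squares supported in `S` of
total masses `≤ M₁` and `≤ M₂`, then so is `F₁ + F₂` with mass `≤ M₁ + M₂`. [folklore] -/
theorem tame_add (p : ℕ) (S : Finset ℕ) (F₁ F₂ : ℂ[X]) (M₁ M₂ : ℝ)
    (h₁ : ∃ (s : ℕ) (c : Fin s → ℂ) (w : Fin s → ℂ[X]), (∀ j, (w j).support ⊆ S) ∧
      ((X : ℂ[X]) ^ p - 1 ∣ (∑ j, C (c j) * w j ^ 2) - F₁) ∧ (∑ j, sqMass (c j) (w j)) ≤ M₁)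
    (h₂ : ∃ (s : ℕ) (c : Fin s → ℂ) (w : Fin s → ℂ[X]), (∀ j, (w j).support ⊆ S) ∧
      ((X : ℂ[X]) ^ p - 1 ∣ (∑ j, C (c j) * w j ^ 2) - F₂) ∧ (∑ j, sqMass (c j) (w j)) ≤ M₂) :
    ∃ (s : ℕ) (c : Fin s → ℂ) (w : Fin s → ℂ[X]), (∀ j, (w j).support ⊆ S) ∧
      ((X : ℂ[X]) ^ p - 1 ∣ (∑ j, C (c j) * w j ^ 2) - (F₁ + F₂)) ∧ (∑ j, sqMass (c j) (w j)) ≤ M₁ + M₂ := by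
  obtain ⟨s₁, c₁, w₁, hS₁, hd₁, hm₁⟩ := h₁
  obtain ⟨s₂, c₂, w₂, hS₂, hd₂, hm₂⟩ := h₂
  refine ⟨s₁ + s₂, Fin.append c₁ c₂, Fin.append w₁ w₂, support_append_subset w₁ w₂ hS₁ hS₂, ?_, ?_⟩
  · rw [sum_sq_append]
    have e : (∑ j, C (c₁ j) * w₁ j ^ 2) + (∑ j, C (c₂ j) * w₂ j ^ 2) - (F₁ + F₂) =
        ((∑ j, C (c₁ j) * w₁ j ^ 2) - F₁) + ((∑ j, C (c₂ j) * w₂ j ^ 2) - F₂) := by ring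
    rw [e]; exact dvd_add hd₁ hd₂
  · rw [sum_sqMass_append]; exact add_le_add hm₁ hm₂

/-- Rescaling the weights rescales the square-sum. [folklore] -/
theorem sum_sq_smul {s : ℕ} (κ : ℂ) (c : Fin s → ℂ) (w : Fin s → ℂ[X]) :
    (∑ j, C (κ * c j) * w j ^ 2) = C κ * ∑ j, C (c j) * w j ^ 2 := by
  rw [Finset.mul_sum]
  exact Finset.sum_congr rfl fun j _ => by rw [map_mul, mul_assoc]

/-- Rescaling a weight rescales the mass by `|κ|`. [folklore] -/
theorem sqMass_smul (κ c : ℂ) (w : ℂ[X]) : sqMass (κ * c) w = ‖κ‖ * sqMass c w := by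
  unfold sqMass; rw [norm_mul, mul_assoc]

/-- **Homogeneity of tameness.**  If `F` is carried inside `S` with mass `≤ M`, then `κ·F` is carried inside `S` with mass
`≤ |κ|·M`. [folklore] -/
theorem tame_smul (p : ℕ) (S : Finset ℕ) (F : ℂ[X]) (M : ℝ) (κ : ℂ)
    (h : ∃ (s : ℕ) (c : Fin s → ℂ) (w : Fin s → ℂ[X]), (∀ j, (w j).support ⊆ S) ∧
      ((X : ℂ[X]) ^ p - 1 ∣ (∑ j, C (c j) * w j ^ 2) - F) ∧ (∑ j, sqMass (c j) (w j)) ≤ M) :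
    ∃ (s : ℕ) (c : Fin s → ℂ) (w : Fin s → ℂ[X]), (∀ j, (w j).support ⊆ S) ∧
      ((X : ℂ[X]) ^ p - 1 ∣ (∑ j, C (c j) * w j ^ 2) - C κ * F) ∧ (∑ j, sqMass (c j) (w j)) ≤ ‖κ‖ * M := by
  obtain ⟨s, c, w, hS, hd, hm⟩ := h
  refine ⟨s, fun j => κ * c j, w, hS, ?_, ?_⟩
  · rw [sum_sq_smul, ← mul_sub]; exact Dvd.dvd.mul_left hd _
  · simp_rw [sqMass_smul]
    rw [← Finset.mul_sum]
    exact mul_le_mul_of_nonneg_left hm (norm_nonneg κ)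

/-- **Finite additivity.**  If every `F t` (`t ∈ T`) is carried inside `S` with mass `≤ M t`, then `Σ_{t∈T} F t` is carried inside
`S` with mass `≤ Σ_{t∈T} M t`. [folklore] -/
theorem tame_sum {ι : Type*} (p : ℕ) (S : Finset ℕ) (T : Finset ι) (F : ι → ℂ[X]) (M : ι → ℝ)
    (h : ∀ t ∈ T, ∃ (s : ℕ) (c : Fin s → ℂ) (w : Fin s → ℂ[X]), (∀ j, (w j).support ⊆ S) ∧
      ((X : ℂ[X]) ^ p - 1 ∣ (∑ j, C (c j) * w j ^ 2) - F t) ∧ (∑ j, sqMass (c j) (w j)) ≤ M t) :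
    ∃ (s : ℕ) (c : Fin s → ℂ) (w : Fin s → ℂ[X]), (∀ j, (w j).support ⊆ S) ∧
      ((X : ℂ[X]) ^ p - 1 ∣ (∑ j, C (c j) * w j ^ 2) - ∑ t ∈ T, F t) ∧
      (∑ j, sqMass (c j) (w j)) ≤ ∑ t ∈ T, M t := by
  classical
  induction T using Finset.induction_on with
  | empty =>
    refine ⟨0, Fin.elim0, Fin.elim0, fun j => Fin.elim0 j, ?_, ?_⟩
    · simp
    · simp
  | insert a T ha ih =>
    have hrest := ih (fun t ht => h t (Finset.mem_insert_of_mem ht))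
    have hfirst := h a (Finset.mem_insert_self a T)
    rw [Finset.sum_insert ha, Finset.sum_insert ha]
    exact tame_add p S (F a) (∑ t ∈ T, F t) (M a) (∑ t ∈ T, M t) hfirst hrest

end Toolkit

end

end Summit.ValiantsHypothesis.ValiantsHypothesis.Theorems.FeketeSOSHardPaleyRIP
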